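import Literature.NumberTheory.Sieve.ArithmeticLargeSieve
import Mathlib.NumberTheory.Harmonic.Bounds
import HarnessLib

/-!
# The Brun–Titchmarsh inequality (intervals and arithmetic progressions) from Montgomery's arithmetic
# large sieve, PROVED

Topic `Literature/NumberTheory/Sieve`; a leaf over `ArithmeticLargeSieve.lean` (Montgomery's arithmetic
large sieve `card_filter_mul_montgomeryL_le`: a set of integers in `(M, M+N]` avoiding `ω(p)` classes
modulo each prime `p ≤ Q` has at most `(N − 1 + Q²)/L(Q)` elements).

Bateman–Diamond, *Analytic Number Theory*, §13.2, Theorem 13.3 (Brun–Titchmarsh inequality): for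
`(q, a) = 1`, `x ≥ 0`, `y ≥ 4q`, `π(x+y; q, a) − π(x; q, a) ≤ 2y/(φ(q) log(y/q)) · {1 + O(log log(y/q)/log(y/q))}`,
proved there from Theorem 12.9 (Montgomery's sieve) with ONE excluded class per prime and the lower bound
`Q(X) = ∑_{ℓ ≤ X, (ℓ,q)=1} μ²(ℓ) ∏_{p∣ℓ} (p−1)⁻¹ = ∑_{(m,q)=1, sqf(m) ≤ X} 1/m ≥ ∑_{m ≤ X, (m,q)=1} 1/m ≥ (φ(q)/q) log X`.
This file proves the theorem in PARAMETRIC form, with every constant explicit and no `O(·)` — first for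
`q = 1` (primes in an interval), then for a general modulus `q ≥ 1` (second part, appended):

* `harmonicOver_le_sqfWeightOver` — for every finite set of primes `P` and every `X`,
  `∑_{m ≤ X, p∣m ⇒ p∈P} 1/m ≤ ∑_{ℓ ≤ X sqf, p∣ℓ ⇒ p∈P} ∏_{p∣ℓ} (p−1)⁻¹` (induction on `P`, one prime at a
  time: both sides satisfy the same recursion in `p`, the left one as an inequality);
* `harmonic_le_sum_squarefree_prod_inv` — hence `∑_{m ≤ X} 1/m ≤ ∑_{ℓ ≤ X} μ²(ℓ)/φ(ℓ)` (the display of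
  the printed proof), and `log X ≤ ∑_{m≤X} 1/m` (Mathlib's `log_add_one_le_harmonic`);
* `card_primes_Ioc_le_largeSieve` — **for all `M, N` and `X ≥ 2`: `π(M+N) − π(M) ≤ (N − 1 + X²)/log X + X`**
  (the primes `> X` of `(M, M+N]` avoid `0 (mod p)` for all `p ≤ X`; the primes `≤ X` are at most `X`).
  With `X² = N/log N` this is the printed `2N/log N · (1 + O(log log N/log N))`; the choice of `X` is
  left to the user so that the statement stays free of asymptotic notation;
* `harmonicOver_le_prod_mul_harmonicOver_sdiff` — removing the primes of `R` from the allowed set costs at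
  most `∏_{p∈R} p/(p−1)`; with `prod_primeFactors_div_sub_one_eq` (`∏_{p∣q} p/(p−1) = q/φ(q)`) this is the
  printed step `∑_{m ≤ X, (m,q)=1} 1/m ≥ (φ(q)/q) ∑_{m≤X} 1/m` (`log_le_mul_harmonicOver_coprime`);
* `card_primes_arithProg_le_largeSieve` — **Theorem 13.3 for a modulus `q ≥ 1`: for all `a, M, N` and
  `X ≥ 2`, `#{M < n ≤ M+N : nq + a prime} ≤ (q/φ(q)) · (N − 1 + X²)/log X + X/q + 1`** (one excluded class
  `−a q⁻¹ (mod p)` for the primes `p ≤ X`, `p ∤ q`, none for `p ∣ q`; the hypothesis `(a,q) = 1` of the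
  printed statement is not needed for the upper bound).

Relation to the tree: `BrunTitchmarshShortInterval.lean` proves the WEAK form
`#{N < p ≤ N+M} ≤ C M/log M` with an unspecified absolute `C` from the beta-sieve ("the classical
constant `2` … is not asserted"); the present bound is explicit and gives the constant `2 + o(1)`.

* `card_primes_Ioc_le_two_add` (appended) — the classical form: `∀ ε > 0 ∃ N₀ ∀ N ≥ N₀ ∀ M`,
  `π(M+N) − π(M) ≤ (2 + ε) N/log N` (`X = ⌊√N/log N⌋`); `card_primes_arithProg_le_two_add` — the
  same for progressions, uniformly in `q, a, M`: `#{M < n ≤ M+N : nq + a prime} ≤ (2+ε)(q/φ(q)) N/log N`,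
  i.e. `π(x+y; q, a) − π(x; q, a) ≤ (2+ε) y/(φ(q) log(y/q))` for `y/q ≥ N₀(ε)`.

NOT here: Montgomery–Vaughan's error-free form `2y/(φ(q) log(y/q))`
(1973, by the weighted large sieve), quoted in Montgomery 1978 p. 561; Shiu's generalisation to
multiplicative functions is `Literature.NumberTheory.Sieve.Shiu1980BrunTitchmarsh` (proved in the tree).

## References

* P. T. Bateman, H. G. Diamond, *Analytic Number Theory: An Introductory Course*, World Scientific
  (2004), §13.2, Theorem 13.3 and its proof (pp. 315–317; pp. 240–241 of the held PDF).
  [cite: BatemanDiamond2004, Thm 13.3, §13.2 p. 315]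
* H. L. Montgomery, *The analytic principle of the large sieve*, Bull. AMS 84 (1978), p. 561 (the
  Brun–Titchmarsh bound as a corollary of the arithmetic large sieve). [cite: Montgomery1978, p. 561]
-/

open Finset Real

namespace Literature.NumberTheory.Sieve.ArithmeticLargeSieve

/-! ### The two sums `A(X, P)` and `B(X, P)` -/

/-- `A(X, P) = ∑_{m ≤ X, p ∣ m ⇒ p ∈ P} 1/m`: the harmonic sum over the integers `1 ≤ m ≤ X` all of whose
prime factors lie in `P`. [folklore] -/
noncomputable def harmonicOver (X : ℕ) (P : Finset ℕ) : ℝ :=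
  ∑ m ∈ (Icc 1 X).filter (fun m => m.primeFactors ⊆ P), (1 : ℝ) / m

/-- `B(X, P) = ∑_{ℓ ≤ X squarefree, p ∣ ℓ ⇒ p ∈ P} ∏_{p ∣ ℓ} 1/(p − 1)`: Montgomery's `L(X)` for one excluded
class per prime, restricted to moduli composed of primes in `P`. [folklore] -/
noncomputable def sqfWeightOver (X : ℕ) (P : Finset ℕ) : ℝ :=
  ∑ ℓ ∈ (Icc 1 X).filter (fun ℓ => Squarefree ℓ ∧ ℓ.primeFactors ⊆ P),
    ∏ p ∈ ℓ.primeFactors, (1 : ℝ) / ((p : ℝ) - 1)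

/-- The weights `∏_{p∣ℓ} (p−1)⁻¹` are non-negative. [folklore] -/
private theorem weight_nonneg (ℓ : ℕ) : 0 ≤ ∏ p ∈ ℓ.primeFactors, (1 : ℝ) / ((p : ℝ) - 1) := by
  refine prod_nonneg fun p hp => div_nonneg zero_le_one ?_
  have h2 : (2 : ℝ) ≤ p := by exact_mod_cast (Nat.prime_of_mem_primeFactors hp).two_le
  linarith

/-- `A(X,P) ≥ 0`. [folklore] -/
private theorem harmonicOver_nonneg (X : ℕ) (P : Finset ℕ) : 0 ≤ harmonicOver X P :=
  sum_nonneg fun m _ => by positivity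

/-- `B(X,P) ≥ 0`. [folklore] -/
private theorem sqfWeightOver_nonneg (X : ℕ) (P : Finset ℕ) : 0 ≤ sqfWeightOver X P :=
  sum_nonneg fun ℓ _ => weight_nonneg ℓ

/-- `B(·,P)` is monotone in `X`. [folklore] -/
private theorem sqfWeightOver_mono {Y Y' : ℕ} (h : Y ≤ Y') (P : Finset ℕ) :
    sqfWeightOver Y P ≤ sqfWeightOver Y' P := by
  unfold sqfWeightOver
  refine sum_le_sum_of_subset_of_nonneg ?_ fun ℓ _ _ => weight_nonneg ℓ
  intro ℓ hℓ
  simp only [mem_filter, mem_Icc] at hℓ ⊢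
  exact ⟨⟨hℓ.1.1, hℓ.1.2.trans h⟩, hℓ.2⟩

/-- `A(0,P) = 0`. [folklore] -/
private theorem harmonicOver_zero (P : Finset ℕ) : harmonicOver 0 P = 0 := by
  unfold harmonicOver
  rw [show Icc 1 0 = (∅ : Finset ℕ) by decide]
  simp

/-- `B(0,P) = 0`. [folklore] -/
private theorem sqfWeightOver_zero (P : Finset ℕ) : sqfWeightOver 0 P = 0 := by
  unfold sqfWeightOver
  rw [show Icc 1 0 = (∅ : Finset ℕ) by decide]
  simp

/-! ### One prime at a time -/

/-- `A(X, P) ≤ A(X, P ∖ {p}) + p⁻¹ A(⌊X/p⌋, P)` for `p ∈ P` prime: split `m` according to `p ∤ m` /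
`m = p m'`. [folklore] -/
private theorem harmonicOver_le_erase_add {X p : ℕ} {P : Finset ℕ} (hp : p.Prime) :
    harmonicOver X P ≤ harmonicOver X (P.erase p) + (1 : ℝ) / p * harmonicOver (X / p) P := by
  unfold harmonicOver
  set S := (Icc 1 X).filter (fun m => m.primeFactors ⊆ P) with hS
  rw [← sum_filter_add_sum_filter_not S (fun m => p ∣ m), add_comm]
  refine add_le_add ?_ ?_
  · -- `p ∤ m`
    refine sum_le_sum_of_subset_of_nonneg ?_ fun m _ _ => by positivity
    intro m hm
    simp only [hS, mem_filter, mem_Icc] at hm ⊢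
    obtain ⟨⟨hmI, hsub⟩, hndvd⟩ := hm
    refine ⟨hmI, fun q hq => ?_⟩
    rw [mem_erase]
    refine ⟨?_, hsub hq⟩
    rintro rfl
    exact hndvd (Nat.dvd_of_mem_primeFactors hq)
  · -- `p ∣ m`: `m = p (m/p)`
    set T := (Icc 1 (X / p)).filter (fun m => m.primeFactors ⊆ P) with hT
    have hinj : Set.InjOn (fun m => p * m) ↑T := fun a _ b _ h =>
      Nat.eq_of_mul_eq_mul_left hp.pos h
    have hsub : S.filter (fun m => p ∣ m) ⊆ T.image (fun m => p * m) := by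
      intro m hm
      simp only [hS, mem_filter, mem_Icc] at hm
      obtain ⟨⟨⟨hm1, hmX⟩, hsub⟩, hdvd⟩ := hm
      rw [mem_image]
      refine ⟨m / p, ?_, Nat.mul_div_cancel' hdvd⟩
      simp only [hT, mem_filter, mem_Icc]
      refine ⟨⟨?_, Nat.div_le_div_right hmX⟩, ?_⟩
      · exact Nat.div_pos (Nat.le_of_dvd (by omega) hdvd) hp.pos
      · exact (Nat.primeFactors_mono (Nat.div_dvd_of_dvd hdvd) (by omega)).trans hsub
    calc ∑ m ∈ S.filter (fun m => p ∣ m), (1 : ℝ) / m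
        ≤ ∑ m ∈ T.image (fun m => p * m), (1 : ℝ) / m :=
          sum_le_sum_of_subset_of_nonneg hsub fun m _ _ => by positivity
      _ = ∑ m ∈ T, (1 : ℝ) / ((p * m : ℕ) : ℝ) := sum_image hinj
      _ = (1 : ℝ) / p * ∑ m ∈ T, (1 : ℝ) / m := by
          rw [mul_sum]
          refine sum_congr rfl fun m _ => ?_
          push_cast
          rw [one_div_mul_one_div]

/-- `B(Y, P) = B(Y, P ∖ {p}) + (p − 1)⁻¹ B(⌊Y/p⌋, P ∖ {p})` for `p ∈ P` prime: a squarefree `ℓ` with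
`p ∣ ℓ` is `p ℓ'` with `p ∤ ℓ'`. [folklore] -/
private theorem sqfWeightOver_eq_erase_add {Y p : ℕ} {P : Finset ℕ} (hp : p.Prime) (hpP : p ∈ P) :
    sqfWeightOver Y P = sqfWeightOver Y (P.erase p) +
      (1 : ℝ) / ((p : ℝ) - 1) * sqfWeightOver (Y / p) (P.erase p) := by
  unfold sqfWeightOver
  set S := (Icc 1 Y).filter (fun ℓ => Squarefree ℓ ∧ ℓ.primeFactors ⊆ P) with hS
  set S' := (Icc 1 Y).filter (fun ℓ => Squarefree ℓ ∧ ℓ.primeFactors ⊆ P.erase p) with hS'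
  set T := (Icc 1 (Y / p)).filter (fun ℓ => Squarefree ℓ ∧ ℓ.primeFactors ⊆ P.erase p) with hT
  rw [← sum_filter_add_sum_filter_not S (fun ℓ => p ∣ ℓ), add_comm]
  congr 1
  · -- `p ∤ ℓ`: exactly the moduli with prime factors in `P ∖ {p}`
    refine sum_congr ?_ fun _ _ => rfl
    ext ℓ
    simp only [hS, hS', mem_filter, mem_Icc]
    constructor
    · rintro ⟨⟨hI, hsq, hsub⟩, hndvd⟩
      refine ⟨hI, hsq, fun q hq => mem_erase.mpr ⟨?_, hsub hq⟩⟩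
      rintro rfl
      exact hndvd (Nat.dvd_of_mem_primeFactors hq)
    · rintro ⟨hI, hsq, hsub⟩
      refine ⟨⟨hI, hsq, fun q hq => mem_of_mem_erase (hsub hq)⟩, fun hdvd => ?_⟩
      have hmem : p ∈ ℓ.primeFactors := Nat.mem_primeFactors.mpr ⟨hp, hdvd, by omega⟩
      exact (mem_erase.mp (hsub hmem)).1 rfl
  · -- `p ∣ ℓ`: `ℓ = p ℓ'`
    have hinj : Set.InjOn (fun m => p * m) ↑T := fun a _ b _ h =>
      Nat.eq_of_mul_eq_mul_left hp.pos h
    have heq : S.filter (fun ℓ => p ∣ ℓ) = T.image (fun m => p * m) := by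
      ext ℓ
      simp only [hS, hT, mem_filter, mem_Icc, mem_image]
      constructor
      · rintro ⟨⟨⟨h1, hY⟩, hsq, hsub⟩, hdvd⟩
        refine ⟨ℓ / p, ⟨⟨?_, Nat.div_le_div_right hY⟩, ?_, ?_⟩, Nat.mul_div_cancel' hdvd⟩
        · exact Nat.div_pos (Nat.le_of_dvd (by omega) hdvd) hp.pos
        · exact hsq.squarefree_of_dvd (Nat.div_dvd_of_dvd hdvd)
        · intro q hq
          have hq' : q ∈ ℓ.primeFactors :=
            Nat.primeFactors_mono (Nat.div_dvd_of_dvd hdvd) (by omega) hq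
          refine mem_erase.mpr ⟨fun hqp => ?_, hsub hq'⟩
          -- `q = p ∣ ℓ / p` contradicts squarefreeness
          rw [hqp] at hq
          have h2 : p * p ∣ ℓ := by
            have := Nat.mul_dvd_mul_left p (Nat.dvd_of_mem_primeFactors hq)
            rwa [Nat.mul_div_cancel' hdvd] at this
          have hu := hsq p h2
          rw [Nat.isUnit_iff] at hu
          exact hp.one_lt.ne' hu
      · rintro ⟨m, ⟨⟨hm1, hmY⟩, hsq, hsub⟩, rfl⟩
        have hpm : ¬ p ∣ m := fun hdvd =>
          (mem_erase.mp (hsub (Nat.mem_primeFactors.mpr ⟨hp, hdvd, by omega⟩))).1 rfl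
        refine ⟨⟨⟨?_, ?_⟩, ?_, ?_⟩, dvd_mul_right p m⟩
        · exact le_trans hm1 (Nat.le_mul_of_pos_left m hp.pos)
        · have h := (Nat.le_div_iff_mul_le hp.pos).mp hmY
          rw [mul_comm] at h
          exact h
        · exact (Nat.squarefree_mul ((Nat.Prime.coprime_iff_not_dvd hp).mpr hpm)).mpr
            ⟨hp.squarefree, hsq⟩
        · rw [Nat.primeFactors_mul hp.ne_zero (by omega), hp.primeFactors]
          intro q hq
          rcases mem_union.mp hq with hq | hq
          · rw [mem_singleton] at hq; rw [hq]; exact hpP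
          · exact mem_of_mem_erase (hsub hq)
    rw [heq, sum_image hinj, mul_sum]
    refine sum_congr rfl fun m hm => ?_
    simp only [hT, mem_filter, mem_Icc] at hm
    obtain ⟨⟨hm1, -⟩, -, hsub⟩ := hm
    have hpm : p ∉ m.primeFactors := fun hmem => (mem_erase.mp (hsub hmem)).1 rfl
    rw [Nat.primeFactors_mul hp.ne_zero (by omega), hp.primeFactors, ← insert_eq,
      prod_insert hpm]

/-- **`A(X, P) ≤ B(X, P)`** for every finite set of primes `P`: the harmonic sum over the integers
`m ≤ X` composed of primes in `P` is at most `∑_{ℓ ≤ X sqf, p∣ℓ ⇒ p ∈ P} ∏_{p∣ℓ} (p−1)⁻¹` (Bateman–Diamond,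
proof of Thm 13.3: "`∑ μ²(ℓ)∏(1/p + 1/p² + ⋯) = ∑_{sqf(m) ≤ X} 1/m ≥ ∑_{m ≤ X} 1/m`"). By induction on `P`,
one prime at a time. [cite: BatemanDiamond2004, Thm 13.3 (proof), §13.2 p. 315] -/
theorem harmonicOver_le_sqfWeightOver (P : Finset ℕ) (hP : ∀ p ∈ P, p.Prime) (X : ℕ) :
    harmonicOver X P ≤ sqfWeightOver X P := by
  induction P using Finset.induction_on generalizing X with
  | empty =>
    -- only `m = 1` (resp. `ℓ = 1`) survives
    unfold harmonicOver sqfWeightOver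
    have h1 : (Icc 1 X).filter (fun m => m.primeFactors ⊆ (∅ : Finset ℕ)) =
        (Icc 1 X).filter (fun ℓ => Squarefree ℓ ∧ ℓ.primeFactors ⊆ (∅ : Finset ℕ)) := by
      ext m
      simp only [mem_filter, mem_Icc, subset_empty, Nat.primeFactors_eq_empty]
      constructor
      · rintro ⟨hI, h⟩
        rcases h with h | h
        · omega
        · subst h; exact ⟨hI, squarefree_one, Or.inr rfl⟩
      · rintro ⟨hI, -, h⟩; exact ⟨hI, h⟩
    rw [h1]
    refine sum_le_sum fun m hm => ?_
    simp only [mem_filter, mem_Icc, subset_empty, Nat.primeFactors_eq_empty] at hm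
    rcases hm.2.2 with h | h
    · omega
    · subst h; simp
  | @insert p P' hpP' ih =>
    have hp : p.Prime := hP p (mem_insert_self p P')
    have hP' : ∀ q ∈ P', q.Prime := fun q hq => hP q (mem_insert_of_mem hq)
    have herase : (insert p P').erase p = P' := by
      rw [erase_insert hpP']
    induction X using Nat.strong_induction_on with
    | _ X ihX =>
      rcases Nat.eq_zero_or_pos X with hX | hX
      · subst hX; rw [harmonicOver_zero, sqfWeightOver_zero]
      have hp1 : (1 : ℝ) < p := by exact_mod_cast hp.one_lt
      have hlt : X / p < X := Nat.div_lt_self hX hp.one_lt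
      have hA := harmonicOver_le_erase_add (X := X) (P := insert p P') hp
      rw [herase] at hA
      have hB := sqfWeightOver_eq_erase_add (Y := X) hp (mem_insert_self p P')
      rw [herase] at hB
      have hB' := sqfWeightOver_eq_erase_add (Y := X / p) hp (mem_insert_self p P')
      rw [herase] at hB'
      have hmono : sqfWeightOver (X / p / p) P' ≤ sqfWeightOver (X / p) P' :=
        sqfWeightOver_mono (Nat.div_le_self _ _) P'
      have h1 := ih hP' X
      have h2 := ihX (X / p) hlt
      have hBn := sqfWeightOver_nonneg (X / p) P'
      have hpinv : (0 : ℝ) ≤ 1 / p := by positivity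
      have key : (1 : ℝ) / p * sqfWeightOver (X / p) (insert p P') ≤
          (1 : ℝ) / ((p : ℝ) - 1) * sqfWeightOver (X / p) P' := by
        rw [hB']
        have : (1 : ℝ) / p * (sqfWeightOver (X / p) P' +
            1 / ((p : ℝ) - 1) * sqfWeightOver (X / p / p) P') ≤
            (1 : ℝ) / p * (sqfWeightOver (X / p) P' + 1 / ((p : ℝ) - 1) * sqfWeightOver (X / p) P') := by
          refine mul_le_mul_of_nonneg_left ?_ hpinv
          have : (0 : ℝ) ≤ 1 / ((p : ℝ) - 1) := div_nonneg zero_le_one (by linarith)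
          nlinarith
        refine this.trans (le_of_eq ?_)
        have hp1' : (p : ℝ) - 1 ≠ 0 := by linarith
        have hp0' : (p : ℝ) ≠ 0 := by linarith
        field_simp
        ring
      calc harmonicOver X (insert p P')
          ≤ harmonicOver X P' + (1 : ℝ) / p * harmonicOver (X / p) (insert p P') := hA
        _ ≤ sqfWeightOver X P' + (1 : ℝ) / p * sqfWeightOver (X / p) (insert p P') := by
            gcongr
        _ ≤ sqfWeightOver X P' + (1 : ℝ) / ((p : ℝ) - 1) * sqfWeightOver (X / p) P' := by
            linarith
        _ = sqfWeightOver X (insert p P') := hB.symm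

/-! ### `L(X) ≥ ∑_{m ≤ X} 1/m ≥ log X` for one excluded class per prime -/

/-- Montgomery's `L(X)` for ONE excluded class modulo each prime dominates the harmonic sum:
`∑_{ℓ ≤ X} μ²(ℓ)/φ(ℓ) = ∑_{ℓ ≤ X} μ²(ℓ) ∏_{p∣ℓ} (p−1)⁻¹ ≥ ∑_{m ≤ X} 1/m`.
[cite: BatemanDiamond2004, Thm 13.3 (proof), §13.2 p. 315] -/
theorem harmonic_le_sum_squarefree_prod_inv (X : ℕ) :
    ∑ m ∈ Icc 1 X, (1 : ℝ) / m ≤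
      ∑ ℓ ∈ (Icc 1 X).filter Squarefree, ∏ p ∈ ℓ.primeFactors, (1 : ℝ) / ((p : ℝ) - 1) := by
  set P := (range (X + 1)).filter Nat.Prime with hPdef
  have hP : ∀ p ∈ P, p.Prime := fun p hp => (mem_filter.mp hp).2
  have hsubP : ∀ m ∈ Icc 1 X, m.primeFactors ⊆ P := by
    intro m hm q hq
    rw [mem_Icc] at hm
    have hqp := Nat.prime_of_mem_primeFactors hq
    have hle : q ≤ m := Nat.le_of_dvd (by omega) (Nat.dvd_of_mem_primeFactors hq)
    exact mem_filter.mpr ⟨mem_range.mpr (by omega), hqp⟩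
  have hA : harmonicOver X P = ∑ m ∈ Icc 1 X, (1 : ℝ) / m := by
    unfold harmonicOver
    rw [filter_true_of_mem hsubP]
  have hB : sqfWeightOver X P ≤
      ∑ ℓ ∈ (Icc 1 X).filter Squarefree, ∏ p ∈ ℓ.primeFactors, (1 : ℝ) / ((p : ℝ) - 1) := by
    unfold sqfWeightOver
    refine sum_le_sum_of_subset_of_nonneg (fun ℓ hℓ => ?_) fun ℓ _ _ => weight_nonneg ℓ
    simp only [mem_filter] at hℓ ⊢
    exact ⟨hℓ.1, hℓ.2.1⟩
  rw [← hA]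
  exact (harmonicOver_le_sqfWeightOver P hP X).trans hB

/-- `log X ≤ ∑_{m ≤ X} 1/m` (Mathlib's `log_add_one_le_harmonic`). [folklore] -/
private theorem log_le_harmonic_sum (X : ℕ) : Real.log X ≤ ∑ m ∈ Icc 1 X, (1 : ℝ) / m := by
  rcases Nat.eq_zero_or_pos X with hX | hX
  · subst hX; simp
  have h1 : Real.log X ≤ Real.log ((X + 1 : ℕ) : ℝ) :=
    Real.log_le_log (by exact_mod_cast hX) (by push_cast; linarith)
  have h2 := log_add_one_le_harmonic X
  have h3 : ((harmonic X : ℚ) : ℝ) = ∑ m ∈ Icc 1 X, (1 : ℝ) / m := by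
    rw [harmonic_eq_sum_Icc]
    push_cast
    refine sum_congr rfl fun m _ => ?_
    rw [one_div]
  linarith [h3 ▸ h2]

/-! ### The Brun–Titchmarsh inequality for intervals -/

open Classical in
/-- **Brun–Titchmarsh via the large sieve** (Bateman–Diamond Thm 13.3, the case `q = 1`, in parametric
form): for all `M, N` and every `X ≥ 2`,
`π(M + N) − π(M) ≤ (N − 1 + X²)/log X + X`.
Proof: the primes `> X` in `(M, M+N]` avoid the class `0 (mod p)` for every prime `p ≤ X`, so Montgomery's
arithmetic large sieve (`card_filter_mul_montgomeryL_le`, one class per prime) bounds their number by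
`(N − 1 + X²)/L(X)` with `L(X) = ∑_{ℓ≤X} μ²(ℓ)/φ(ℓ) ≥ ∑_{m≤X} 1/m ≥ log X`; the primes `≤ X` number at most
`X`.  Choosing `X² = N/log N` gives the printed `2N/log N · (1 + O(log log N/log N))`.
[cite: BatemanDiamond2004, Thm 13.3, §13.2 p. 315; Montgomery1978, p. 561] -/
theorem card_primes_Ioc_le_largeSieve (M N X : ℕ) (hX : 2 ≤ X) :
    ((((Ioc M (M + N)).filter Nat.Prime).card : ℕ) : ℝ) ≤
      ((N : ℝ) - 1 + (X : ℝ) ^ 2) / Real.log X + X := by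
  set J : ℕ → Finset ℕ := fun _ => {0} with hJ
  have hJp : ∀ p : ℕ, p.Prime → p ≤ X → J p ⊆ range p ∧ (J p).card < p := by
    intro p hp _
    refine ⟨?_, ?_⟩
    · intro j hj; simp only [hJ, mem_singleton] at hj; subst hj; exact mem_range.mpr hp.pos
    · simp only [hJ, card_singleton]; exact hp.one_lt
  -- the sifted set and the large primes
  set S := (Ioc M (M + N)).filter (fun n => ∀ p : ℕ, p.Prime → p ≤ X → n % p ∉ J p) with hS
  set Pr := (Ioc M (M + N)).filter Nat.Prime with hPr
  have hsplit : Pr.card ≤ S.card + X := by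
    have h1 : Pr ⊆ (Pr.filter (fun n => X < n)) ∪ (Pr.filter (fun n => ¬ X < n)) := by
      rw [filter_union_filter_not_eq]
    have h2 : Pr.filter (fun n => X < n) ⊆ S := by
      intro n hn
      simp only [hPr, hS, mem_filter] at hn ⊢
      obtain ⟨⟨hI, hn⟩, hXn⟩ := hn
      refine ⟨hI, fun p hp hpX => ?_⟩
      simp only [hJ, mem_singleton]
      intro h0
      have hdvd : p ∣ n := Nat.dvd_of_mod_eq_zero h0
      rcases (Nat.dvd_prime hn).mp hdvd with h | h
      · exact hp.one_lt.ne' h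
      · omega
    have h3 : (Pr.filter (fun n => ¬ X < n)).card ≤ X := by
      calc (Pr.filter (fun n => ¬ X < n)).card ≤ (Icc 1 X).card := by
            refine card_le_card fun n hn => ?_
            simp only [hPr, mem_filter, mem_Ioc, not_lt] at hn
            rw [mem_Icc]
            exact ⟨hn.1.2.one_lt.le, hn.2⟩
        _ = X := by simp
    calc Pr.card ≤ ((Pr.filter (fun n => X < n)) ∪ (Pr.filter (fun n => ¬ X < n))).card :=
          card_le_card h1
      _ ≤ (Pr.filter (fun n => X < n)).card + (Pr.filter (fun n => ¬ X < n)).card :=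
          card_union_le _ _
      _ ≤ S.card + X := add_le_add (card_le_card h2) h3
  -- the large sieve bound for `S`
  have hLS := card_filter_mul_montgomeryL_le M N X (by omega) J hJp
  -- `L(X) ≥ log X > 0`
  have hL : Real.log X ≤ montgomeryL J X := by
    rw [montgomeryL_eq_sum_montgomeryWeight]
    refine (log_le_harmonic_sum X).trans ((harmonic_le_sum_squarefree_prod_inv X).trans (le_of_eq ?_))
    refine sum_congr rfl fun ℓ _ => ?_
    unfold montgomeryWeight
    refine prod_congr rfl fun p _ => ?_
    simp only [hJ, card_singleton, Nat.cast_one]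
  have hlog : 0 < Real.log X := Real.log_pos (by exact_mod_cast (by omega : 1 < X))
  have hLpos : 0 < montgomeryL J X := lt_of_lt_of_le hlog hL
  have hnum : (0 : ℝ) ≤ (X : ℝ) ^ 2 + N - 1 := by
    have : (2 : ℝ) ≤ X := by exact_mod_cast hX
    nlinarith
  have hS_le : (S.card : ℝ) ≤ ((N : ℝ) - 1 + (X : ℝ) ^ 2) / Real.log X := by
    rw [le_div_iff₀ hlog]
    calc (S.card : ℝ) * Real.log X ≤ (S.card : ℝ) * montgomeryL J X :=
          mul_le_mul_of_nonneg_left hL (Nat.cast_nonneg _)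
      _ ≤ (X : ℝ) ^ 2 + N - 1 := hLS
      _ = (N : ℝ) - 1 + (X : ℝ) ^ 2 := by ring
  have : (Pr.card : ℝ) ≤ (S.card : ℝ) + X := by exact_mod_cast hsplit
  linarith

/-! ### Arithmetic progressions: `∑_{m ≤ X, (m,q)=1} 1/m ≥ (φ(q)/q) ∑_{m ≤ X} 1/m` and Theorem 13.3 -/

/-- `A(·, P)` is monotone in `X`. [folklore] -/
private theorem harmonicOver_mono {Y Y' : ℕ} (h : Y ≤ Y') (P : Finset ℕ) :
    harmonicOver Y P ≤ harmonicOver Y' P := by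
  unfold harmonicOver
  refine sum_le_sum_of_subset_of_nonneg ?_ fun m _ _ => by positivity
  intro m hm
  simp only [mem_filter, mem_Icc] at hm ⊢
  exact ⟨⟨hm.1.1, hm.1.2.trans h⟩, hm.2⟩

/-- Removing the primes of `R` from the allowed set costs at most the factor `∏_{p ∈ R} p/(p−1)`:
`A(X, P) ≤ (∏_{p∈R} p/(p−1)) · A(X, P ∖ R)` (one prime at a time: `A(X,P) ≤ A(X,P∖p) + p⁻¹A(X,P)`).
This is Bateman–Diamond's step `∑_{m≤X,(m,q)=1} 1/m ≥ ∏_{p∣q}(1 − 1/p) ∑_{j ≤ X} 1/j`.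
[cite: BatemanDiamond2004, Thm 13.3 (proof), §13.2 p. 315] -/
theorem harmonicOver_le_prod_mul_harmonicOver_sdiff (P R : Finset ℕ) (hR : ∀ p ∈ R, p.Prime) (X : ℕ) :
    harmonicOver X P ≤ (∏ p ∈ R, (p : ℝ) / ((p : ℝ) - 1)) * harmonicOver X (P \ R) := by
  induction R using Finset.induction_on with
  | empty => simp
  | @insert p R' hpR' ih =>
    have hp : p.Prime := hR p (mem_insert_self p R')
    have hR'' : ∀ r ∈ R', r.Prime := fun r hr => hR r (mem_insert_of_mem hr)
    have hp1 : (1 : ℝ) < p := by exact_mod_cast hp.one_lt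
    have hfac : (0 : ℝ) ≤ ∏ r ∈ R', (r : ℝ) / ((r : ℝ) - 1) := by
      refine prod_nonneg fun r hr => div_nonneg (Nat.cast_nonneg _) ?_
      have : (2 : ℝ) ≤ r := by exact_mod_cast (hR'' r hr).two_le
      linarith
    -- one prime: `A(X, P ∖ R') ≤ (p/(p−1)) · A(X, P ∖ R)`
    have hstep : harmonicOver X (P \ R') ≤ (p : ℝ) / ((p : ℝ) - 1) * harmonicOver X (P \ insert p R') := by
      by_cases hpP : p ∈ P \ R'
      · have h1 := harmonicOver_le_erase_add (X := X) (P := P \ R') hp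
        have herase : (P \ R').erase p = P \ insert p R' := by
          ext r
          simp only [mem_erase, mem_sdiff, mem_insert, not_or]
          tauto
        rw [herase] at h1
        have h2 : harmonicOver (X / p) (P \ R') ≤ harmonicOver X (P \ R') :=
          harmonicOver_mono (Nat.div_le_self _ _) _
        have h3 : (0 : ℝ) ≤ 1 / p := by positivity
        have h4 : harmonicOver X (P \ R') * (1 - 1 / p) ≤ harmonicOver X (P \ insert p R') := by
          nlinarith [mul_le_mul_of_nonneg_left h2 h3]
        rw [div_mul_eq_mul_div, le_div_iff₀ (by linarith : (0 : ℝ) < (p : ℝ) - 1)]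
        have hp0' : (p : ℝ) ≠ 0 := by linarith
        have e : harmonicOver X (P \ R') * ((p : ℝ) - 1) =
            harmonicOver X (P \ R') * (1 - 1 / p) * p := by
          field_simp
        rw [e]
        calc harmonicOver X (P \ R') * (1 - 1 / (p : ℝ)) * p
            ≤ harmonicOver X (P \ insert p R') * p :=
              mul_le_mul_of_nonneg_right h4 (Nat.cast_nonneg _)
          _ = (p : ℝ) * harmonicOver X (P \ insert p R') := mul_comm _ _
      · -- `p ∉ P ∖ R'`: the two sets coincide and the factor is `≥ 1`
        have heq : P \ insert p R' = P \ R' := by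
          ext r
          simp only [mem_sdiff, mem_insert, not_or]
          constructor
          · rintro ⟨h1, -, h2⟩; exact ⟨h1, h2⟩
          · rintro ⟨h1, h2⟩
            refine ⟨h1, ?_, h2⟩
            rintro rfl
            exact hpP (mem_sdiff.mpr ⟨h1, h2⟩)
        rw [heq]
        have hge : (1 : ℝ) ≤ (p : ℝ) / ((p : ℝ) - 1) := by
          rw [le_div_iff₀ (by linarith)]; linarith
        have := harmonicOver_nonneg X (P \ R')
        nlinarith
    calc harmonicOver X P ≤ (∏ r ∈ R', (r : ℝ) / ((r : ℝ) - 1)) * harmonicOver X (P \ R') := ih hR''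
      _ ≤ (∏ r ∈ R', (r : ℝ) / ((r : ℝ) - 1)) *
            ((p : ℝ) / ((p : ℝ) - 1) * harmonicOver X (P \ insert p R')) :=
          mul_le_mul_of_nonneg_left hstep hfac
      _ = (∏ r ∈ insert p R', (r : ℝ) / ((r : ℝ) - 1)) * harmonicOver X (P \ insert p R') := by
          rw [prod_insert hpR']; ring

/-- Euler's product in the form used here: `∏_{p∣q} p/(p−1) = q/φ(q)` for `q ≥ 1`.
[cite: BatemanDiamond2004, Thm 13.3 (proof), §13.2 p. 315] -/
theorem prod_primeFactors_div_sub_one_eq (q : ℕ) (hq : 0 < q) :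
    ∏ p ∈ q.primeFactors, (p : ℝ) / ((p : ℝ) - 1) = (q : ℝ) / (Nat.totient q : ℝ) := by
  have hφ : ((Nat.totient q : ℕ) : ℝ) = (q : ℝ) * ∏ p ∈ q.primeFactors, (1 - (p : ℝ)⁻¹) := by
    have := Nat.totient_eq_mul_prod_factors q
    have h' : (((Nat.totient q : ℕ) : ℚ) : ℝ) = (((q : ℚ) * ∏ p ∈ q.primeFactors, (1 - (p : ℚ)⁻¹) : ℚ) : ℝ) := by
      rw [this]
    push_cast at h'
    exact h'
  have hφpos : (0 : ℝ) < (Nat.totient q : ℕ) := by exact_mod_cast Nat.totient_pos.mpr hq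
  rw [eq_div_iff hφpos.ne', hφ, mul_comm, mul_assoc, ← prod_mul_distrib]
  have : ∏ p ∈ q.primeFactors, ((1 - (p : ℝ)⁻¹) * ((p : ℝ) / ((p : ℝ) - 1))) = 1 := by
    refine prod_eq_one fun p hp => ?_
    have h2 : (2 : ℝ) ≤ p := by exact_mod_cast (Nat.prime_of_mem_primeFactors hp).two_le
    have hp0 : (p : ℝ) ≠ 0 := by linarith
    have hp1 : (p : ℝ) - 1 ≠ 0 := by linarith
    field_simp
  rw [this, mul_one]

/-- **`∑_{m ≤ X, (m,q)=1} 1/m ≥ (φ(q)/q) log X`** in the form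
`log X ≤ (q/φ(q)) · ∑_{m ≤ X, p ∣ m ⇒ p ∤ q} 1/m` (`q ≥ 1`).
[cite: BatemanDiamond2004, Thm 13.3 (proof), §13.2 p. 315] -/
theorem log_le_mul_harmonicOver_coprime (q X : ℕ) (hq : 0 < q) :
    Real.log X ≤ (q : ℝ) / (Nat.totient q : ℝ) *
      harmonicOver X (((range (X + 1)).filter Nat.Prime) \ q.primeFactors) := by
  set P := (range (X + 1)).filter Nat.Prime with hPdef
  have hsubP : ∀ m ∈ Icc 1 X, m.primeFactors ⊆ P := by
    intro m hm r hr
    rw [mem_Icc] at hm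
    have hle : r ≤ m := Nat.le_of_dvd (by omega) (Nat.dvd_of_mem_primeFactors hr)
    exact mem_filter.mpr ⟨mem_range.mpr (by omega), Nat.prime_of_mem_primeFactors hr⟩
  have hA : harmonicOver X P = ∑ m ∈ Icc 1 X, (1 : ℝ) / m := by
    unfold harmonicOver; rw [filter_true_of_mem hsubP]
  rw [← prod_primeFactors_div_sub_one_eq q hq]
  refine (log_le_harmonic_sum X).trans ?_
  rw [← hA]
  exact harmonicOver_le_prod_mul_harmonicOver_sdiff P q.primeFactors
    (fun p hp => Nat.prime_of_mem_primeFactors hp) X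

open Classical in
/-- **Brun–Titchmarsh for arithmetic progressions via the large sieve** (Bateman–Diamond Thm 13.3, in
parametric form): for `q ≥ 1`, ANY `a` (for `(a,q) > 1` the left side is at most `1` and the bound is
trivially true, so the printed hypothesis `(a, q) = 1` is not needed), all `M, N` and every `X ≥ 2`,
`#{M < n ≤ M + N : nq + a prime} ≤ (q/φ(q)) (N − 1 + X²)/log X + (X/q + 1)` — i.e. with `x = Mq + a`,
`y = Nq`: `π(x+y; q, a) − π(x; q, a) ≤ (N − 1 + X²)/((φ(q)/q) log X) + X/q + 1`.
Proof (loc. cit.): if `nq + a` is a prime `> X`, then for every prime `p ≤ X` with `p ∤ q`,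
`n ≢ −a q⁻¹ (mod p)` — one excluded class per such prime, none for `p ∣ q` — so Montgomery's sieve gives
`≤ (N − 1 + X²)/L` with `L ≥ ∑_{ℓ ≤ X sqf, (ℓ,q)=1} ∏_{p∣ℓ}(p−1)⁻¹ ≥ ∑_{m ≤ X,(m,q)=1} 1/m ≥ (φ(q)/q) log X`;
the `n` with `nq + a ≤ X` number at most `X/q + 1`.  With `X² = (y/q)/log(y/q)` this is the printed
`2y/(φ(q) log(y/q)) · {1 + O(log log(y/q)/log(y/q))}`.
[cite: BatemanDiamond2004, Thm 13.3, §13.2 p. 315; Montgomery1978, p. 561] -/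
theorem card_primes_arithProg_le_largeSieve (q a M N X : ℕ) (hq : 0 < q) (hX : 2 ≤ X) :
    ((((Ioc M (M + N)).filter (fun n => (n * q + a).Prime)).card : ℕ) : ℝ) ≤
      (q : ℝ) / (Nat.totient q : ℝ) * (((N : ℝ) - 1 + (X : ℝ) ^ 2) / Real.log X) + ((X / q : ℕ) + 1) := by
  -- the excluded class modulo `p ∤ q`: `r_p = −a q⁻¹ (mod p)`
  set J : ℕ → Finset ℕ := fun p =>
    if p ∣ q then ∅ else {((-(a : ZMod p)) * ((q : ZMod p)⁻¹)).val} with hJ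
  have hJp : ∀ p : ℕ, p.Prime → p ≤ X → J p ⊆ range p ∧ (J p).card < p := by
    intro p hp _
    by_cases hpq : p ∣ q
    · simp only [hJ, if_pos hpq]; exact ⟨empty_subset _, by simp [hp.pos]⟩
    · simp only [hJ, if_neg hpq]
      haveI : NeZero p := ⟨hp.ne_zero⟩
      refine ⟨?_, by simp [hp.one_lt]⟩
      intro j hj
      rw [mem_singleton] at hj; subst hj
      exact mem_range.mpr (ZMod.val_lt _)
  -- key: `n % p = r_p` forces `p ∣ n q + a`
  have hkey : ∀ p : ℕ, p.Prime → ¬ p ∣ q → ∀ n : ℕ, n % p ∈ J p → p ∣ n * q + a := by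
    intro p hp hpq n hn
    simp only [hJ, if_neg hpq, mem_singleton] at hn
    haveI : NeZero p := ⟨hp.ne_zero⟩
    have hcop : Nat.Coprime q p := (Nat.coprime_comm.mp ((Nat.Prime.coprime_iff_not_dvd hp).mpr hpq))
    have hn' : (n : ZMod p) = (-(a : ZMod p)) * ((q : ZMod p)⁻¹) := by
      have h1 : ((n % p : ℕ) : ZMod p) = (n : ZMod p) := by
        rw [← ZMod.natCast_mod n p]
      rw [← h1, hn, ZMod.natCast_zmod_val]
    rw [← ZMod.natCast_eq_zero_iff]
    push_cast
    rw [hn', mul_assoc, mul_comm ((q : ZMod p)⁻¹), ZMod.coe_mul_inv_eq_one q hcop]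
    ring
  -- the sifted set and the large values
  set S := (Ioc M (M + N)).filter (fun n => ∀ p : ℕ, p.Prime → p ≤ X → n % p ∉ J p) with hS
  set Pr := (Ioc M (M + N)).filter (fun n => (n * q + a).Prime) with hPr
  have hsplit : Pr.card ≤ S.card + (X / q + 1) := by
    have h1 : Pr ⊆ (Pr.filter (fun n => X < n * q + a)) ∪ (Pr.filter (fun n => ¬ X < n * q + a)) := by
      rw [filter_union_filter_not_eq]
    have h2 : Pr.filter (fun n => X < n * q + a) ⊆ S := by
      intro n hn
      simp only [hPr, hS, mem_filter] at hn ⊢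
      obtain ⟨⟨hI, hprime⟩, hXn⟩ := hn
      refine ⟨hI, fun p hp hpX hmem => ?_⟩
      by_cases hpq : p ∣ q
      · simp only [hJ, if_pos hpq] at hmem; simp at hmem
      · have hdvd := hkey p hp hpq n hmem
        rcases (Nat.dvd_prime hprime).mp hdvd with h | h
        · exact hp.one_lt.ne' h
        · omega
    have h3 : (Pr.filter (fun n => ¬ X < n * q + a)).card ≤ X / q + 1 := by
      calc (Pr.filter (fun n => ¬ X < n * q + a)).card ≤ (range (X / q + 1)).card := by
            refine card_le_card fun n hn => ?_
            simp only [hPr, mem_filter, not_lt] at hn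
            rw [mem_range, Nat.lt_succ_iff, Nat.le_div_iff_mul_le hq]
            have := hn.2; omega
        _ = X / q + 1 := card_range _
    calc Pr.card ≤ ((Pr.filter (fun n => X < n * q + a)) ∪ (Pr.filter (fun n => ¬ X < n * q + a))).card :=
          card_le_card h1
      _ ≤ _ := card_union_le _ _
      _ ≤ S.card + (X / q + 1) := add_le_add (card_le_card h2) h3
  -- the large sieve bound for `S`
  have hLS := card_filter_mul_montgomeryL_le M N X (by omega) J hJp
  -- `L ≥ B(X, P ∖ pf q) ≥ A(X, P ∖ pf q)` and `(q/φ q) · A ≥ log X`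
  set P := (range (X + 1)).filter Nat.Prime with hPdef
  have hLB : sqfWeightOver X (P \ q.primeFactors) ≤ montgomeryL J X := by
    rw [montgomeryL_eq_sum_montgomeryWeight]
    unfold sqfWeightOver montgomeryWeight
    have hw0 : ∀ ℓ ∈ (Icc 1 X).filter Squarefree,
        0 ≤ ∏ p ∈ ℓ.primeFactors, ((J p).card : ℝ) / ((p : ℝ) - (J p).card) := by
      intro ℓ _
      refine prod_nonneg fun p hp => div_nonneg (Nat.cast_nonneg _) ?_
      have hpp := Nat.prime_of_mem_primeFactors hp
      have h2 : (2 : ℝ) ≤ p := by exact_mod_cast hpp.two_le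
      by_cases hpq : p ∣ q
      · simp only [hJ, if_pos hpq, card_empty, Nat.cast_zero]; linarith
      · simp only [hJ, if_neg hpq, card_singleton, Nat.cast_one]; linarith
    calc ∑ ℓ ∈ (Icc 1 X).filter (fun ℓ => Squarefree ℓ ∧ ℓ.primeFactors ⊆ P \ q.primeFactors),
          ∏ p ∈ ℓ.primeFactors, (1 : ℝ) / ((p : ℝ) - 1)
        = ∑ ℓ ∈ (Icc 1 X).filter (fun ℓ => Squarefree ℓ ∧ ℓ.primeFactors ⊆ P \ q.primeFactors),
          ∏ p ∈ ℓ.primeFactors, ((J p).card : ℝ) / ((p : ℝ) - (J p).card) := by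
          refine sum_congr rfl fun ℓ hℓ => prod_congr rfl fun p hp => ?_
          obtain ⟨-, -, hsub⟩ := mem_filter.mp hℓ
          have hpq : ¬ p ∣ q := by
            intro hdvd
            have hmem := hsub hp
            rw [mem_sdiff] at hmem
            exact hmem.2 (Nat.mem_primeFactors.mpr ⟨Nat.prime_of_mem_primeFactors hp, hdvd, hq.ne'⟩)
          simp only [hJ, if_neg hpq, card_singleton, Nat.cast_one]
      _ ≤ ∑ ℓ ∈ (Icc 1 X).filter Squarefree,
          ∏ p ∈ ℓ.primeFactors, ((J p).card : ℝ) / ((p : ℝ) - (J p).card) := by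
          refine sum_le_sum_of_subset_of_nonneg (fun ℓ hℓ => ?_) fun ℓ hℓ _ => hw0 ℓ hℓ
          simp only [mem_filter] at hℓ ⊢
          exact ⟨hℓ.1, hℓ.2.1⟩
  have hP : ∀ p ∈ P \ q.primeFactors, p.Prime := fun p hp => (mem_filter.mp (mem_sdiff.mp hp).1).2
  have hAB := harmonicOver_le_sqfWeightOver (P \ q.primeFactors) hP X
  have hlogA := log_le_mul_harmonicOver_coprime q X hq
  have hlog : 0 < Real.log X := Real.log_pos (by exact_mod_cast (by omega : 1 < X))
  have hqφ : (0 : ℝ) < (q : ℝ) / (Nat.totient q : ℝ) :=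
    div_pos (by exact_mod_cast hq) (by exact_mod_cast Nat.totient_pos.mpr hq)
  -- `log X ≤ (q/φ) L`
  have hL : Real.log X ≤ (q : ℝ) / (Nat.totient q : ℝ) * montgomeryL J X :=
    hlogA.trans (mul_le_mul_of_nonneg_left (hAB.trans hLB) hqφ.le)
  have hLpos : 0 < montgomeryL J X := by
    have := one_le_montgomeryL J (by omega : 1 ≤ X) fun p hp hpX => (hJp p hp hpX).2
    linarith
  have hS_le : (S.card : ℝ) ≤ (q : ℝ) / (Nat.totient q : ℝ) * (((N : ℝ) - 1 + (X : ℝ) ^ 2) / Real.log X) := by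
    rw [mul_div_assoc', le_div_iff₀ hlog]
    calc (S.card : ℝ) * Real.log X ≤ (S.card : ℝ) * ((q : ℝ) / (Nat.totient q : ℝ) * montgomeryL J X) :=
          mul_le_mul_of_nonneg_left hL (Nat.cast_nonneg _)
      _ = (q : ℝ) / (Nat.totient q : ℝ) * ((S.card : ℝ) * montgomeryL J X) := by ring
      _ ≤ (q : ℝ) / (Nat.totient q : ℝ) * ((X : ℝ) ^ 2 + N - 1) :=
          mul_le_mul_of_nonneg_left hLS hqφ.le
      _ = (q : ℝ) / (Nat.totient q : ℝ) * ((N : ℝ) - 1 + (X : ℝ) ^ 2) := by ring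
  have : (Pr.card : ℝ) ≤ (S.card : ℝ) + ((X / q : ℕ) + 1 : ℝ) := by exact_mod_cast hsplit
  linarith

/-! ### The classical form `π(M+N) − π(M) ≤ (2 + ε) N/log N` -/

section TwoPlusEpsilon

open Filter Topology

/-- The sieve parameter `X_N = ⌊√N/log N⌋` (Bateman–Diamond's choice `X² = N/log N` up to the harmless
extra `log`). [cite: BatemanDiamond2004, Thm 13.3 (proof), §13.2 p. 316] -/
noncomputable def btParam (N : ℕ) : ℕ := ⌊Real.sqrt N / Real.log N⌋₊

/-- `√x/log x → ∞`. [folklore] -/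
private theorem tendsto_sqrt_div_log : Tendsto (fun x : ℝ => Real.sqrt x / Real.log x) atTop atTop := by
  have h14 : Tendsto (fun x : ℝ => x ^ (1 / 4 : ℝ)) atTop atTop := tendsto_rpow_atTop (by norm_num)
  have hlog : ∀ᶠ x : ℝ in atTop, Real.log x ≤ x ^ (1 / 4 : ℝ) := by
    have h := (isLittleO_log_rpow_atTop (by norm_num : (0 : ℝ) < 1 / 4)).bound (zero_lt_one)
    filter_upwards [h, eventually_ge_atTop 1] with x hx hx1
    rw [one_mul, Real.norm_eq_abs, Real.norm_eq_abs, abs_of_nonneg (Real.log_nonneg hx1),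
      abs_of_nonneg (by positivity)] at hx
    exact hx
  refine tendsto_atTop_mono' atTop ?_ h14
  filter_upwards [hlog, eventually_gt_atTop (Real.exp 1)] with x hx hxe
  have hx0 : 0 < x := (Real.exp_pos 1).trans hxe
  have hlogpos : 0 < Real.log x := by
    have := Real.log_lt_log (Real.exp_pos 1) hxe
    rw [Real.log_exp] at this
    linarith
  rw [le_div_iff₀ hlogpos]
  calc x ^ (1 / 4 : ℝ) * Real.log x ≤ x ^ (1 / 4 : ℝ) * x ^ (1 / 4 : ℝ) :=
        mul_le_mul_of_nonneg_left hx (by positivity)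
    _ = Real.sqrt x := by
        rw [← Real.rpow_add hx0, Real.sqrt_eq_rpow]; norm_num

/-- `X_N → ∞`. [folklore] -/
private theorem tendsto_btParam : Tendsto btParam atTop atTop :=
  tendsto_nat_floor_atTop.comp (tendsto_sqrt_div_log.comp tendsto_natCast_atTop_atTop)

/-- `log X_N / log N → 1/2`. [folklore] -/
private theorem tendsto_log_btParam_div :
    Tendsto (fun N : ℕ => Real.log (btParam N) / Real.log N) atTop (𝓝 (1 / 2)) := by
  -- the correction `(log 2 + log log N)/log N → 0`
  have hlogN : Tendsto (fun N : ℕ => Real.log N) atTop atTop :=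
    Real.tendsto_log_atTop.comp tendsto_natCast_atTop_atTop
  have hcorr : Tendsto (fun N : ℕ => (Real.log 2 + Real.log (Real.log N)) / Real.log N) atTop (𝓝 0) := by
    have h1 : Tendsto (fun N : ℕ => Real.log 2 / Real.log N) atTop (𝓝 0) :=
      tendsto_const_nhds.div_atTop hlogN
    have h2 : Tendsto (fun N : ℕ => Real.log (Real.log N) / Real.log N) atTop (𝓝 0) :=
      Real.isLittleO_log_id_atTop.tendsto_div_nhds_zero.comp hlogN
    have h12 : Tendsto (fun N : ℕ => Real.log 2 / Real.log N + Real.log (Real.log N) / Real.log N)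
        atTop (𝓝 (0 + 0)) := h1.add (h2.congr fun N => rfl)
    rw [add_zero] at h12
    refine h12.congr fun N => ?_
    rw [add_div]
  have hlow : Tendsto (fun N : ℕ => 1 / 2 - (Real.log 2 + Real.log (Real.log N)) / Real.log N) atTop
      (𝓝 (1 / 2)) := by
    have h : Tendsto (fun N : ℕ => 1 / 2 - (Real.log 2 + Real.log (Real.log N)) / Real.log N) atTop
        (𝓝 (1 / 2 - 0)) := tendsto_const_nhds.sub hcorr
    rwa [sub_zero] at h
  -- eventual bounds on `X_N`
  have hbig : ∀ᶠ N : ℕ in atTop, 2 ≤ Real.sqrt N / Real.log N :=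
    (tendsto_sqrt_div_log.comp tendsto_natCast_atTop_atTop).eventually_ge_atTop 2
  have hN3 : ∀ᶠ N : ℕ in atTop, 3 ≤ N := eventually_ge_atTop 3
  refine tendsto_of_tendsto_of_tendsto_of_le_of_le' hlow tendsto_const_nhds ?_ ?_
  · filter_upwards [hbig, hN3] with N hb hN
    have hNr : (3 : ℝ) ≤ N := by exact_mod_cast hN
    have hlogN1 : 1 < Real.log N := by
      rw [← Real.log_exp 1]
      refine Real.log_lt_log (Real.exp_pos 1) (lt_of_lt_of_le ?_ hNr)
      have := Real.exp_one_lt_d9; norm_num at this; linarith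
    have hlogNpos : 0 < Real.log N := by linarith
    -- `X_N ≥ √N/log N − 1 ≥ √N/(2 log N)`
    have hX : Real.sqrt N / (2 * Real.log N) ≤ (btParam N : ℝ) := by
      have h1 : Real.sqrt N / Real.log N - 1 ≤ (btParam N : ℝ) := by
        have := Nat.sub_one_lt_floor (Real.sqrt N / Real.log N)
        unfold btParam; linarith
      have h2 : Real.sqrt N / (2 * Real.log N) = Real.sqrt N / Real.log N / 2 := by
        rw [div_div, mul_comm]
      rw [h2]; linarith
    have hspos : 0 < Real.sqrt N := Real.sqrt_pos.mpr (by linarith)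
    have hq : 0 < Real.sqrt N / (2 * Real.log N) := by positivity
    have hsqrt : Real.log (Real.sqrt N) = Real.log N / 2 := by
      rw [Real.sqrt_eq_rpow, Real.log_rpow (by linarith)]; ring
    have hlogX : Real.log N / 2 - (Real.log 2 + Real.log (Real.log N)) ≤ Real.log (btParam N) := by
      have h1 := Real.log_le_log hq hX
      rw [Real.log_div hspos.ne' (by positivity), Real.log_mul (by norm_num) hlogNpos.ne', hsqrt] at h1
      linarith
    rw [le_div_iff₀ hlogNpos]
    have : (1 / 2 - (Real.log 2 + Real.log (Real.log N)) / Real.log N) * Real.log N =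
        Real.log N / 2 - (Real.log 2 + Real.log (Real.log N)) := by
      field_simp
    rw [this]
    exact hlogX
  · filter_upwards [hN3] with N hN
    have hNr : (3 : ℝ) ≤ N := by exact_mod_cast hN
    have hlogN1 : 1 < Real.log N := by
      rw [← Real.log_exp 1]
      refine Real.log_lt_log (Real.exp_pos 1) (lt_of_lt_of_le ?_ hNr)
      have := Real.exp_one_lt_d9; norm_num at this; linarith
    have hlogNpos : 0 < Real.log N := by linarith
    rw [div_le_iff₀ hlogNpos]
    -- `X_N ≤ √N/log N ≤ √N`, so `log X_N ≤ (log N)/2` (also when `X_N = 0`)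
    rcases Nat.eq_zero_or_pos (btParam N) with h0 | hpos
    · rw [h0]; simp; linarith
    · have hXle : (btParam N : ℝ) ≤ Real.sqrt N := by
        have h1 : (btParam N : ℝ) ≤ Real.sqrt N / Real.log N :=
          Nat.floor_le (div_nonneg (Real.sqrt_nonneg _) hlogNpos.le)
        refine h1.trans (div_le_self (Real.sqrt_nonneg _) hlogN1.le)
      have h1 := Real.log_le_log (by exact_mod_cast hpos) hXle
      rw [Real.sqrt_eq_rpow, Real.log_rpow (by linarith)] at h1
      linarith

/-- `(X_N² + N − 1)/N → 1`. [folklore] -/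
private theorem tendsto_main_factor :
    Tendsto (fun N : ℕ => (((btParam N : ℝ)) ^ 2 + N - 1) / N) atTop (𝓝 1) := by
  have hlogN : Tendsto (fun N : ℕ => Real.log N) atTop atTop :=
    Real.tendsto_log_atTop.comp tendsto_natCast_atTop_atTop
  -- upper bound `1 + 1/log² N`, lower bound `1 − 1/N`
  have hup : Tendsto (fun N : ℕ => 1 + 1 / Real.log N ^ 2) atTop (𝓝 1) := by
    have h : Tendsto (fun N : ℕ => 1 / Real.log N ^ 2) atTop (𝓝 0) :=
      tendsto_const_nhds.div_atTop ((tendsto_pow_atTop two_ne_zero).comp hlogN)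
    have h' : Tendsto (fun N : ℕ => 1 + 1 / Real.log N ^ 2) atTop (𝓝 (1 + 0)) :=
      tendsto_const_nhds.add h
    rwa [add_zero] at h'
  have hlowt : Tendsto (fun N : ℕ => 1 - 1 / (N : ℝ)) atTop (𝓝 1) := by
    have h : Tendsto (fun N : ℕ => 1 / (N : ℝ)) atTop (𝓝 0) :=
      tendsto_const_nhds.div_atTop tendsto_natCast_atTop_atTop
    have h' : Tendsto (fun N : ℕ => 1 - 1 / (N : ℝ)) atTop (𝓝 (1 - 0)) :=
      tendsto_const_nhds.sub h
    rwa [sub_zero] at h'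
  have hN3 : ∀ᶠ N : ℕ in atTop, 3 ≤ N := eventually_ge_atTop 3
  refine tendsto_of_tendsto_of_tendsto_of_le_of_le' hlowt hup ?_ ?_
  · filter_upwards [hN3] with N hN
    have hNr : (3 : ℝ) ≤ N := by exact_mod_cast hN
    have hNpos : (0 : ℝ) < N := by linarith
    rw [le_div_iff₀ hNpos]
    have : (1 - 1 / (N : ℝ)) * N = N - 1 := by field_simp
    rw [this]
    nlinarith
  · filter_upwards [hN3] with N hN
    have hNr : (3 : ℝ) ≤ N := by exact_mod_cast hN
    have hNpos : (0 : ℝ) < N := by linarith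
    have hlogN1 : 1 < Real.log N := by
      rw [← Real.log_exp 1]
      refine Real.log_lt_log (Real.exp_pos 1) (lt_of_lt_of_le ?_ hNr)
      have := Real.exp_one_lt_d9; norm_num at this; linarith
    have hlogNpos : 0 < Real.log N := by linarith
    have hX2 : (btParam N : ℝ) ^ 2 ≤ N / Real.log N ^ 2 := by
      have h1 : (btParam N : ℝ) ≤ Real.sqrt N / Real.log N :=
        Nat.floor_le (div_nonneg (Real.sqrt_nonneg _) hlogNpos.le)
      have h0 : (0 : ℝ) ≤ btParam N := Nat.cast_nonneg _
      calc (btParam N : ℝ) ^ 2 ≤ (Real.sqrt N / Real.log N) ^ 2 := pow_le_pow_left₀ h0 h1 2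
        _ = N / Real.log N ^ 2 := by
            rw [div_pow, Real.sq_sqrt hNpos.le]
    rw [div_le_iff₀ hNpos]
    have : (1 + 1 / Real.log N ^ 2) * N = N + N / Real.log N ^ 2 := by
      field_simp
    rw [this]
    linarith


/-- `X_N log N / N → 0`. [folklore] -/
private theorem tendsto_btParam_mul_log_div :
    Tendsto (fun N : ℕ => (btParam N : ℝ) * Real.log N / N) atTop (𝓝 0) := by
  -- `X_N log N/N ≤ (√N/log N) log N/N = 1/√N`
  have hup : Tendsto (fun N : ℕ => 1 / Real.sqrt N) atTop (𝓝 0) := by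
    have h : Tendsto (fun N : ℕ => Real.sqrt N) atTop atTop :=
      (Real.tendsto_sqrt_atTop).comp tendsto_natCast_atTop_atTop
    exact tendsto_const_nhds.div_atTop h
  have hN3 : ∀ᶠ N : ℕ in atTop, 3 ≤ N := eventually_ge_atTop 3
  refine tendsto_of_tendsto_of_tendsto_of_le_of_le' tendsto_const_nhds hup ?_ ?_
  · filter_upwards [hN3] with N hN
    have hNr : (3 : ℝ) ≤ N := by exact_mod_cast hN
    have : 0 ≤ Real.log N := Real.log_nonneg (by linarith)
    positivity
  · filter_upwards [hN3] with N hN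
    have hNr : (3 : ℝ) ≤ N := by exact_mod_cast hN
    have hNpos : (0 : ℝ) < N := by linarith
    have hlogN1 : 1 < Real.log N := by
      rw [← Real.log_exp 1]
      refine Real.log_lt_log (Real.exp_pos 1) (lt_of_lt_of_le ?_ hNr)
      have := Real.exp_one_lt_d9; norm_num at this; linarith
    have hlogNpos : 0 < Real.log N := by linarith
    have hX : (btParam N : ℝ) ≤ Real.sqrt N / Real.log N :=
      Nat.floor_le (div_nonneg (Real.sqrt_nonneg _) hlogNpos.le)
    have hsq : 0 < Real.sqrt N := Real.sqrt_pos.mpr hNpos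
    have hXL : (btParam N : ℝ) * Real.log N ≤ Real.sqrt N := (le_div_iff₀ hlogNpos).mp hX
    rw [div_le_div_iff₀ hNpos hsq, one_mul]
    calc (btParam N : ℝ) * Real.log N * Real.sqrt N ≤ Real.sqrt N * Real.sqrt N :=
          mul_le_mul_of_nonneg_right hXL hsq.le
      _ = N := Real.mul_self_sqrt hNpos.le

/-- **The normalised Brun–Titchmarsh bound tends to `2`**:
`((N − 1 + X_N²)/log X_N + X_N) · log N/N → 2`. [folklore] -/
private theorem tendsto_bt_normalised :
    Tendsto (fun N : ℕ => ((((N : ℝ) - 1 + (btParam N : ℝ) ^ 2) / Real.log (btParam N) +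
      (btParam N : ℝ)) * Real.log N / N)) atTop (𝓝 2) := by
  have hA : Tendsto (fun N : ℕ => (((btParam N : ℝ)) ^ 2 + N - 1) / N) atTop (𝓝 1) :=
    tendsto_main_factor
  have hB : Tendsto (fun N : ℕ => Real.log N / Real.log (btParam N)) atTop (𝓝 2) := by
    have h := (tendsto_log_btParam_div).inv₀ (by norm_num)
    have hval : ((1 / 2 : ℝ))⁻¹ = 2 := by norm_num
    rw [hval] at h
    refine h.congr' ?_
    filter_upwards with N
    rw [inv_div]
  have hE := tendsto_btParam_mul_log_div
  have hsum := (hA.mul hB).add hE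
  have hval : (1 : ℝ) * 2 + 0 = 2 := by norm_num
  rw [hval] at hsum
  refine hsum.congr' ?_
  have hN3 : ∀ᶠ N : ℕ in atTop, 3 ≤ N := eventually_ge_atTop 3
  have hX2 : ∀ᶠ N : ℕ in atTop, 2 ≤ btParam N := tendsto_btParam.eventually_ge_atTop 2
  filter_upwards [hN3, hX2] with N hN hX
  have hNr : (3 : ℝ) ≤ N := by exact_mod_cast hN
  have hNpos : (0 : ℝ) < N := by linarith
  have hXr : (2 : ℝ) ≤ btParam N := by exact_mod_cast hX
  have hlogX : 0 < Real.log (btParam N) := Real.log_pos (by linarith)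
  field_simp
  ring

open Classical in
/-- **Brun–Titchmarsh with the constant `2`** (the classical form of Bateman–Diamond Thm 13.3 for
`q = 1`; Montgomery 1978 p. 561): for every `ε > 0` there is `N₀` such that for all `N ≥ N₀` and ALL `M`,
`π(M + N) − π(M) ≤ (2 + ε) N/log N`.  (Montgomery–Vaughan's weighted sieve removes the `ε`; not
here.) [cite: BatemanDiamond2004, Thm 13.3, §13.2 p. 315; Montgomery1978, p. 561] -/
theorem card_primes_Ioc_le_two_add (ε : ℝ) (hε : 0 < ε) :
    ∃ N₀ : ℕ, ∀ N : ℕ, N₀ ≤ N → ∀ M : ℕ,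
      ((((Ioc M (M + N)).filter Nat.Prime).card : ℕ) : ℝ) ≤ (2 + ε) * N / Real.log N := by
  have hev := tendsto_bt_normalised.eventually_lt_const (by linarith : (2 : ℝ) < 2 + ε)
  have hN3 : ∀ᶠ N : ℕ in atTop, 3 ≤ N := eventually_ge_atTop 3
  have hX2 : ∀ᶠ N : ℕ in atTop, 2 ≤ btParam N := tendsto_btParam.eventually_ge_atTop 2
  obtain ⟨N₀, hN₀⟩ := (hev.and (hN3.and hX2)).exists_forall_of_atTop
  refine ⟨N₀, fun N hN M => ?_⟩
  obtain ⟨hg, hN3', hX⟩ := hN₀ N hN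
  have hNr : (3 : ℝ) ≤ N := by exact_mod_cast hN3'
  have hNpos : (0 : ℝ) < N := by linarith
  have hlogN : 0 < Real.log N := Real.log_pos (by linarith)
  have h := card_primes_Ioc_le_largeSieve M N (btParam N) hX
  set G := ((N : ℝ) - 1 + (btParam N : ℝ) ^ 2) / Real.log (btParam N) + (btParam N : ℝ) with hG
  have hG' : G < (2 + ε) * N / Real.log N := by
    have h1 := hg
    rw [div_lt_iff₀ hNpos] at h1
    rw [lt_div_iff₀ hlogN]
    linarith
  exact h.trans hG'.le

end TwoPlusEpsilon

/-! ### The classical form for arithmetic progressions: `(2 + ε) (q/φ(q)) N/log N`, uniformly in `q, a, M` -/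

section TwoPlusEpsilonAP

open Filter Topology

/-- The normalised AP bound tends to `2`: `((N − 1 + X_N²)/log X_N + X_N + 1) · log N/N → 2`. [folklore] -/
private theorem tendsto_bt_normalised_ap :
    Tendsto (fun N : ℕ => ((((N : ℝ) - 1 + (btParam N : ℝ) ^ 2) / Real.log (btParam N) +
      ((btParam N : ℝ) + 1)) * Real.log N / N)) atTop (𝓝 2) := by
  have h1 := tendsto_bt_normalised
  -- the extra `log N / N → 0`
  have h2 : Tendsto (fun N : ℕ => Real.log N / (N : ℝ)) atTop (𝓝 0) := by
    refine (Real.isLittleO_log_id_atTop.tendsto_div_nhds_zero.comp tendsto_natCast_atTop_atTop).congr ?_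
    intro N; simp only [Function.comp_apply, id_eq]
  have hsum := h1.add h2
  rw [add_zero] at hsum
  refine hsum.congr' ?_
  filter_upwards [eventually_ge_atTop 1] with N hN
  have hNpos : (0 : ℝ) < N := by exact_mod_cast hN
  field_simp
  ring

open Classical in
/-- **The Brun–Titchmarsh theorem** (Bateman–Diamond Thm 13.3 in its classical form, uniformly in the
modulus and the residue): for every `ε > 0` there is `N₀` such that for all `N ≥ N₀`, all `q ≥ 1`, all
`a` and all `M`: `#{M < n ≤ M + N : nq + a prime} ≤ (2 + ε) (q/φ(q)) N / log N` — i.e. with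
`x = Mq + a`, `y = Nq`: `π(x + y; q, a) − π(x; q, a) ≤ (2 + ε) y/(φ(q) log(y/q))` as soon as
`y/q ≥ N₀(ε)`. [cite: BatemanDiamond2004, Thm 13.3, §13.2 p. 315; Montgomery1978, p. 561] -/
theorem card_primes_arithProg_le_two_add (ε : ℝ) (hε : 0 < ε) :
    ∃ N₀ : ℕ, ∀ N : ℕ, N₀ ≤ N → ∀ q a M : ℕ, 0 < q →
      ((((Ioc M (M + N)).filter (fun n => (n * q + a).Prime)).card : ℕ) : ℝ) ≤
        (2 + ε) * ((q : ℝ) / (Nat.totient q : ℝ)) * N / Real.log N := by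
  have hev := tendsto_bt_normalised_ap.eventually_lt_const (by linarith : (2 : ℝ) < 2 + ε)
  have hN3 : ∀ᶠ N : ℕ in atTop, 3 ≤ N := eventually_ge_atTop 3
  have hX2 : ∀ᶠ N : ℕ in atTop, 2 ≤ btParam N := tendsto_btParam.eventually_ge_atTop 2
  obtain ⟨N₀, hN₀⟩ := (hev.and (hN3.and hX2)).exists_forall_of_atTop
  refine ⟨N₀, fun N hN q a M hq => ?_⟩
  obtain ⟨hg, hN3', hX⟩ := hN₀ N hN
  have hNr : (3 : ℝ) ≤ N := by exact_mod_cast hN3'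
  have hNpos : (0 : ℝ) < N := by linarith
  have hlogN : 0 < Real.log N := Real.log_pos (by linarith)
  have hXr : (2 : ℝ) ≤ btParam N := by exact_mod_cast hX
  have hlogX : 0 < Real.log (btParam N) := Real.log_pos (by linarith)
  have h := card_primes_arithProg_le_largeSieve q a M N (btParam N) hq hX
  -- `q/φ(q) ≥ 1`
  have hφpos : (0 : ℝ) < (Nat.totient q : ℝ) := by exact_mod_cast Nat.totient_pos.mpr hq
  have hqφ : (1 : ℝ) ≤ (q : ℝ) / (Nat.totient q : ℝ) := by
    rw [le_div_iff₀ hφpos, one_mul]; exact_mod_cast Nat.totient_le q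
  -- the error term `X/q + 1 ≤ X + 1 ≤ (q/φ(q)) (X + 1)`
  have herr : (((btParam N / q : ℕ) : ℝ) + 1) ≤ (q : ℝ) / (Nat.totient q : ℝ) * ((btParam N : ℝ) + 1) := by
    have h1 : ((btParam N / q : ℕ) : ℝ) ≤ btParam N := by exact_mod_cast Nat.div_le_self _ _
    have h0 : (0 : ℝ) ≤ (btParam N : ℝ) + 1 := by positivity
    nlinarith
  set G := ((N : ℝ) - 1 + (btParam N : ℝ) ^ 2) / Real.log (btParam N) + ((btParam N : ℝ) + 1) with hG
  have hGnonneg : 0 ≤ ((N : ℝ) - 1 + (btParam N : ℝ) ^ 2) / Real.log (btParam N) := by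
    apply div_nonneg _ hlogX.le; nlinarith
  have hG' : G < (2 + ε) * N / Real.log N := by
    have h1 := hg
    rw [div_lt_iff₀ hNpos] at h1
    rw [lt_div_iff₀ hlogN]
    linarith
  calc ((((Ioc M (M + N)).filter (fun n => (n * q + a).Prime)).card : ℕ) : ℝ)
      ≤ (q : ℝ) / (Nat.totient q : ℝ) * (((N : ℝ) - 1 + (btParam N : ℝ) ^ 2) / Real.log (btParam N)) +
          (((btParam N / q : ℕ) : ℝ) + 1) := h
    _ ≤ (q : ℝ) / (Nat.totient q : ℝ) * G := by rw [hG, mul_add]; linarith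
    _ ≤ (q : ℝ) / (Nat.totient q : ℝ) * ((2 + ε) * N / Real.log N) :=
        mul_le_mul_of_nonneg_left hG'.le (le_trans zero_le_one hqφ)
    _ = (2 + ε) * ((q : ℝ) / (Nat.totient q : ℝ)) * N / Real.log N := by ring

end TwoPlusEpsilonAP

end Literature.NumberTheory.Sieve.ArithmeticLargeSieve
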